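import Summits.ResolutionOfSingularities.ResolutionOfSingularities.Theorems.FrobeniusLadderFInjectiveMacaulayficationCentreSpread
import Literature.AlgebraicGeometry.Resolution.MarkedIdealsArithmetic
import Literature.AlgebraicGeometry.Resolution.MarkedIdealsLemmas
import Mathlib.RingTheory.Finiteness.Ideal
import HarnessLib

/-!
# SUPPORT-CONTROLLED SPREAD of a stalk ideal (cluster growth: the junk region of a step made explicit)
# (crux `FInjectiveMacaulayfication` stmt-ResolutionOfSingularities-15315, chain w45a; res-L1-w45a-plan-1 R16.45 (2) «stub-2: `…SpreadSupportControl.lean`,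
# `exists_spread_support_subset` (J″ := spread ⊔ I_Z^N) + the radical form»; seat res-L1-w45a-stub-2)

[OURS · L1 W4.5a] Support file (`--supports stmt-ResolutionOfSingularities-15315 --as helper`); NOT a statement of any manuscript; def-free, unconditional;
AI-written (AI review is weaker than expert review).

* `exists_idealSheafData_stalkIdeal_eq` — EVERY ideal of a stalk `𝒪_{X,ζ}` of a locally Noetherian scheme is the stalk of some ideal sheaf (the
  construction of `CentreSpread.centreSpread` without its side conditions: `J(U) = I ∩ Γ(X,U)` on an affine `U ∋ ζ`, `IsLocalization.map_under`).
* `exists_spread_support_subset` — if `(I_Z)_ζ^N ⊆ (c)` for a closed `Z` then some `J″` has `J″_ζ = (c)` AND `supp J″ ⊆ Z`: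
  `J″ := J ⊔ I_Z^N` with `J_ζ = (c)` (off `Z` the summand `I_Z^N` is the unit ideal; at `ζ` it is swallowed by `(c)`).
* `exists_spread_support_subset_of_le_radical` — the radical form: `(I_Z)_ζ ⊆ √(c)` suffices (Noetherian stalk).
[folklore; cite: GortzWedhorn2020, Prop. 7.32]
-/

-- single-problem summit: the doubled namespace component is forced
set_option linter.dupNamespace false

noncomputable section

namespace Summit.ResolutionOfSingularities.ResolutionOfSingularities.Theorems.FInjectiveMacaulayfication.SpreadSupportControl

open CategoryTheory AlgebraicGeometry TopologicalSpace IsLocalRing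
open Literature.AlgebraicGeometry.Resolution
open Summit.ResolutionOfSingularities.ResolutionOfSingularities.Theorems.FInjectiveMacaulayfication

-- adapted from `CentreSpread.centreSpread` (same construction, without the side conditions `I ≠ ⊥`, `I ≤ 𝔪`)
/-- **Every stalk ideal is the stalk of an ideal sheaf** (locally Noetherian `X`): `J(U) = I ∩ Γ(X, U)` on an affine `U ∋ ζ` extends back to `I`.
[folklore] -/
theorem exists_idealSheafData_stalkIdeal_eq (X : Scheme.{0}) [IsLocallyNoetherian X] (ζ : X) (I : Ideal (X.presheaf.stalk ζ)) :
    ∃ J : X.IdealSheafData, stalkIdeal J ζ = I := by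
  obtain ⟨U₀, hU₀, hζU, -⟩ := exists_isAffineOpen_mem_and_subset (X := X) (x := ζ) (U := ⊤) (Opens.mem_top ζ)
  let U : X.affineOpens := ⟨U₀, hU₀⟩
  letI := TopCat.Presheaf.algebra_section_stalk X.presheaf (⟨ζ, hζU⟩ : (U : X.Opens))
  haveI : IsLocalization.AtPrime (X.presheaf.stalk ζ) (U.2.primeIdealOf ⟨ζ, hζU⟩).asIdeal := U.2.isLocalization_stalk ⟨ζ, hζU⟩
  have hmap : (I.under Γ(X, U)).map (algebraMap Γ(X, U) (X.presheaf.stalk ζ)) = I :=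
    IsLocalization.map_under (U.2.primeIdealOf ⟨ζ, hζU⟩).asIdeal.primeCompl (X.presheaf.stalk ζ) _
  obtain ⟨J, hJU⟩ := CentreSpread.exists_idealSheafData_ideal_eq X U (I.under Γ(X, U))
  refine ⟨J, ?_⟩
  rw [stalkIdeal_eq_map_germ J U hζU, hJU]
  exact hmap

/-- **SUPPORT-CONTROLLED SPREAD.** If a power of the stalk at `ζ` of the ideal of the closed set `Z` lies in `(c)`, then `(c)` is the stalk at `ζ` of
an ideal sheaf supported INSIDE `Z` (`J″ := J ⊔ I_Zᴺ` with `J_ζ = (c)`). [folklore] -/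
theorem exists_spread_support_subset {X₁ : Scheme.{0}} [IsLocallyNoetherian X₁] (Z : Set X₁) (hZ : IsClosed Z) {ζ : X₁} {n : ℕ}
    (c : Fin n → X₁.presheaf.stalk ζ) (N : ℕ)
    (hN : stalkIdeal (Scheme.IdealSheafData.vanishingIdeal ⟨Z, hZ⟩) ζ ^ N ≤ Ideal.span (Set.range c)) :
    ∃ J'' : X₁.IdealSheafData, stalkIdeal J'' ζ = Ideal.span (Set.range c) ∧ (J''.support : Set X₁) ⊆ Z := by
  obtain ⟨J, hJ⟩ := exists_idealSheafData_stalkIdeal_eq X₁ ζ (Ideal.span (Set.range c))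
  refine ⟨J ⊔ Scheme.IdealSheafData.vanishingIdeal ⟨Z, hZ⟩ ^ N, ?_, ?_⟩
  · rw [stalkIdeal_sup, stalkIdeal_pow, hJ]
    exact sup_eq_left.mpr hN
  · intro x hx
    rw [Scheme.IdealSheafData.support_sup] at hx
    have hx' : x ∈ ((Scheme.IdealSheafData.vanishingIdeal ⟨Z, hZ⟩ ^ N).support : Set X₁) := hx.2
    cases N with
    | zero =>
      rw [pow_zero, Scheme.IdealSheafData.one_eq_top, Scheme.IdealSheafData.support_top] at hx'
      exact absurd hx' (Set.notMem_empty x)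
    | succ k =>
      rw [Scheme.IdealSheafData.support_pow_succ, Scheme.IdealSheafData.coe_support_vanishingIdeal] at hx'
      exact hx'

/-- **Radical form**: `(I_Z)_ζ ⊆ √(c)` suffices (the stalk is Noetherian, so some power of `(I_Z)_ζ` lies in `(c)`). [folklore] -/
theorem exists_spread_support_subset_of_le_radical {X₁ : Scheme.{0}} [IsLocallyNoetherian X₁] (Z : Set X₁) (hZ : IsClosed Z) {ζ : X₁} {n : ℕ}
    (c : Fin n → X₁.presheaf.stalk ζ)
    (hrad : stalkIdeal (Scheme.IdealSheafData.vanishingIdeal ⟨Z, hZ⟩) ζ ≤ (Ideal.span (Set.range c)).radical) :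
    ∃ J'' : X₁.IdealSheafData, stalkIdeal J'' ζ = Ideal.span (Set.range c) ∧ (J''.support : Set X₁) ⊆ Z := by
  obtain ⟨N, hN⟩ := Ideal.exists_pow_le_of_le_radical_of_fg hrad (IsNoetherian.noetherian _)
  exact exists_spread_support_subset Z hZ c N hN

end Summit.ResolutionOfSingularities.ResolutionOfSingularities.Theorems.FInjectiveMacaulayfication.SpreadSupportControl

end
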